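import Literature.NumberTheory.GaloisRepresentations.TwistedSumAlgebraic
import Literature.NumberTheory.GaloisRepresentations.ContinuousRep
import Literature.RepresentationTheory.Semisimple.EquivOfCharacter
import Mathlib.LinearAlgebra.Matrix.Charpoly.Eigs
import Mathlib.LinearAlgebra.Charpoly.ToMatrix
import Mathlib.Topology.Algebra.Module.ModuleTopology
import Mathlib.LinearAlgebra.Basis.VectorSpace
import Mathlib.Topology.Algebra.Field
import HarnessLib

/-!
# Twisted sums of continuous semisimple representations: assembly of HLTT Prop. 7.12

Topic `Literature/NumberTheory/GaloisRepresentations` (theorems only).  From the algebraic core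
(`TwistedSumAlgebraic`) to Harris–Lan–Taylor–Thorne, Res. Math. Sci. 3:37 (2016), Prop. 7.12 in
the topological setting of `HarrisLanTaylorThorne2016.prop712Hausdorff`
(`TwistedSumDecomposition`), for `ℳ` unbounded above:
`TwistedSum.exists_framedRep_of_unbounded`.  The discharge `prop712Hausdorff_holds`
(`TwistedSumDecompositionProofs`) reduces the general case to this one (`μ ↦ μ⁻¹`, `ℳ ↦ -ℳ`).

Steps (all proved here): (1) on `𝔉` the characters are `tr ρ_m(f) = ∑ 𝔈¹_f + μ(f)ᵐ ∑ 𝔈²_f`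
(`Matrix.trace_eq_sum_roots_charpoly`), so the two three-term sums of twisted characters agree on
`𝔉`; they are continuous (`FramedRep.continuous_trace`) and `k` is Hausdorff, so they agree on
`Γ` (`Continuous.ext_on`), and Brauer–Nesbitt for semisimple representations
(`Representation.nonempty_equiv_of_character_eq_of_isSemisimple`,
`Literature/RepresentationTheory/Semisimple/EquivOfCharacter`) gives the three-term
equivalences; (2) `TwistedSum.exists_isCompl_forall_equiv_prod_twist` gives
`ρ_m ≃ A ⊕ B ⊗ μ^{m-m₀}`; (3) characteristic polynomials multiply over `⊕`
(`LinearMap.charpoly_prodMap`, `LinearEquiv.charpoly_conj`) and twisting scales roots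
(`roots_charpoly_smul`: `roots χ(cM) = c · roots χ(M)`, via
`χ_{cM}(cX) = cⁿ χ_M(X)`); (4) the generic-twist lemma
`multiset_eq_of_forall_add_map_mul_zpow_eq` (cf. the uniqueness argument in the source's
Cor. 7.3) identifies the roots of `A` and of `B ⊗ μ^{-m₀}` on `𝔉` with `𝔈¹`, `𝔈²`, forcing
`dim A = dim B = d`; (5) a subspace of `kⁿ` has the module topology
(`isModuleTopology_submodule_pi`), the restricted actions are jointly continuous, and
`ContinuousRep.frame` (`ContinuousRep.lean`) frames them as `Γ →ₜ* GL_d(k)`.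

## References

* M. Harris, K.-W. Lan, R. Taylor, J. Thorne, *On the rigid cohomology of certain Shimura
  varieties*, Res. Math. Sci. 3:37 (2016), §7, Prop. 7.12 (p. 232). [HarrisLanTaylorThorneRMS2016]
-/

noncomputable section

open Polynomial
open scoped MonoidAlgebra

namespace Literature.NumberTheory.GaloisRepresentations

namespace TwistedSum

open Literature.RepresentationTheory.Semisimple Literature.RepresentationTheory.FiniteGroups

/-! ### A multiset lemma: twisted sums with a generic twist determine their parts -/

/-- **Generic twists separate.**  Let `u ∈ kˣ` have infinite order and let `S ⊆ ℤ` be infinite.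
If `X₁ ⊔ X₂·uᵐ = Y₁ ⊔ Y₂·uᵐ` (multisets) for all `m ∈ S`, and `0 ∉ X₁`, `0 ∉ Y₁`, then
`X₁ = Y₁` and `X₂ = Y₂`: for all but finitely many `m`, no element of `X₁ ∪ Y₁` is of the form
`a uᵐ` with `a ∈ X₂ ∪ Y₂` (cf. Harris–Lan–Taylor–Thorne, proof of Cor. 7.3, uniqueness).
[folklore] -/
theorem multiset_eq_of_forall_add_map_mul_zpow_eq {k : Type*} [Field k] {u : kˣ}
    (hu : ¬ IsOfFinOrder u) {S : Set ℤ} (hS : S.Infinite) {X₁ X₂ Y₁ Y₂ : Multiset k}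
    (hX : (0 : k) ∉ X₁) (hY : (0 : k) ∉ Y₁)
    (h : ∀ m ∈ S, X₁ + X₂.map (· * ((u ^ m : kˣ) : k)) = Y₁ + Y₂.map (· * ((u ^ m : kˣ) : k))) :
    X₁ = Y₁ ∧ X₂ = Y₂ := by
  classical
  -- the bad exponents
  let bad : Set ℤ := ⋃ a ∈ (X₂ + Y₂).toFinset, ⋃ b ∈ (X₁ + Y₁).toFinset,
    {m : ℤ | a * ((u ^ m : kˣ) : k) = b}
  have hinj : Function.Injective fun m : ℤ => ((u ^ m : kˣ) : k) :=
    Units.val_injective.comp (injective_zpow_iff_not_isOfFinOrder.mpr hu)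
  have hbad : bad.Finite := by
    refine Set.Finite.biUnion (Finset.finite_toSet _) fun a ha => ?_
    refine Set.Finite.biUnion (Finset.finite_toSet _) fun b hb => ?_
    by_cases ha0 : a = 0
    · subst ha0
      have hb0 : b ≠ 0 := by
        rintro rfl
        simp only [Finset.mem_coe, Multiset.mem_toFinset, Multiset.mem_add] at hb
        exact hb.elim hX hY
      have he : {m : ℤ | (0 : k) * ((u ^ m : kˣ) : k) = b} = ∅ :=
        Set.eq_empty_iff_forall_notMem.mpr fun m hm => hb0 (by simpa using hm.symm)
      rw [he]
      exact Set.finite_empty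
    · apply Set.Subsingleton.finite
      intro m hm m' hm'
      simp only [Set.mem_setOf_eq] at hm hm'
      apply hinj
      change ((u ^ m : kˣ) : k) = ((u ^ m' : kˣ) : k)
      rw [← mul_right_inj' ha0, hm, hm']
  obtain ⟨m, hmS, hmbad⟩ : ∃ m ∈ S, m ∉ bad := (Set.Infinite.sdiff hS hbad).nonempty
  have hm := h m hmS
  set c : k := ((u ^ m : kˣ) : k) with hc
  have hc0 : c ≠ 0 := Units.ne_zero _
  -- no `b ∈ X₁ ∪ Y₁` is of the form `a * c` with `a ∈ X₂ ∪ Y₂`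
  have hgood : ∀ a ∈ X₂ + Y₂, ∀ b ∈ X₁ + Y₁, a * c ≠ b := by
    intro a ha b hb hab
    apply hmbad
    simp only [bad, Set.mem_iUnion, Set.mem_setOf_eq, Multiset.mem_toFinset]
    exact ⟨a, ha, b, hb, hab⟩
  have h1 : X₁ = Y₁ := by
    ext b
    by_cases hb : b ∈ X₁ + Y₁
    · have := congrArg (Multiset.count b) hm
      simp only [Multiset.count_add] at this
      have h2 : Multiset.count b (X₂.map (· * c)) = 0 := by
        rw [Multiset.count_eq_zero, Multiset.mem_map]
        rintro ⟨a, ha, rfl⟩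
        exact hgood a (Multiset.mem_add.mpr (Or.inl ha)) _ hb rfl
      have h3 : Multiset.count b (Y₂.map (· * c)) = 0 := by
        rw [Multiset.count_eq_zero, Multiset.mem_map]
        rintro ⟨a, ha, rfl⟩
        exact hgood a (Multiset.mem_add.mpr (Or.inr ha)) _ hb rfl
      omega
    · rw [Multiset.mem_add, not_or] at hb
      rw [Multiset.count_eq_zero.mpr hb.1, Multiset.count_eq_zero.mpr hb.2]
  refine ⟨h1, ?_⟩
  rw [h1, add_right_inj] at hm
  exact Multiset.map_injective (mul_left_injective₀ hc0) hm

/-! ### Roots of the characteristic polynomial of a scalar multiple -/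

/-- `charpoly (c • M)` composed with `X ↦ c X` is `c^n · charpoly M`. [folklore] -/
theorem charpoly_smul_comp_C_mul_X {n : Type*} [Fintype n] [DecidableEq n] {K : Type*} [Field K]
    (M : Matrix n n K) (c : K) :
    ((c • M).charpoly).comp (C c * X) = C (c ^ Fintype.card n) * M.charpoly := by
  have h1 : ((c • M).charpoly).comp (C c * X) =
      (Polynomial.compRingHom (C c * X)) (Matrix.det (Matrix.charmatrix (c • M))) := rfl
  have h2 : (Polynomial.compRingHom (C c * X)).mapMatrix (Matrix.charmatrix (c • M)) =
      C c • Matrix.charmatrix M := by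
    refine Matrix.ext fun i j => ?_
    simp only [RingHom.mapMatrix_apply, Matrix.map_apply, Polynomial.coe_compRingHom_apply,
      Matrix.smul_apply, smul_eq_mul]
    by_cases hij : i = j
    · subst hij
      rw [Matrix.charmatrix_apply_eq, Matrix.charmatrix_apply_eq, Matrix.smul_apply, smul_eq_mul,
        sub_comp, X_comp, C_comp, C_mul]
      ring
    · rw [Matrix.charmatrix_apply_ne _ _ _ hij, Matrix.charmatrix_apply_ne _ _ _ hij,
        Matrix.smul_apply, smul_eq_mul, neg_comp, C_comp, C_mul]
      ring
  rw [h1, RingHom.map_det, h2, Matrix.det_smul, Matrix.charpoly, ← C_pow]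

/-- **Scaling a matrix scales the roots of its characteristic polynomial**:
`roots (charpoly (c • M)) = c · roots (charpoly M)` for `c ≠ 0`. [folklore] -/
theorem roots_charpoly_smul {n : Type*} [Fintype n] [DecidableEq n] {K : Type*} [Field K]
    (M : Matrix n n K) {c : K} (hc : c ≠ 0) :
    (c • M).charpoly.roots = M.charpoly.roots.map (c * ·) := by
  have h := Polynomial.map_roots_comp_C_mul_X_add_C (c • M).charpoly c 0 (isUnit_iff_ne_zero.mpr hc)
  rw [C_0, add_zero, charpoly_smul_comp_C_mul_X, roots_C_mul _ (pow_ne_zero _ hc)] at h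
  rw [← h]
  exact Multiset.map_congr rfl fun x _ => by rw [add_zero]

/-- The same for an endomorphism of a finite free module: `roots (charpoly (c • φ)) =
c · roots (charpoly φ)` for `c ≠ 0`. [folklore] -/
theorem roots_charpoly_smul_linearMap {K : Type*} [Field K] {V : Type*} [AddCommGroup V]
    [Module K V] [FiniteDimensional K V] (φ : Module.End K V) {c : K} (hc : c ≠ 0) :
    (c • φ).charpoly.roots = φ.charpoly.roots.map (c * ·) := by
  let b := Module.Free.chooseBasis K V
  rw [← LinearMap.charpoly_toMatrix φ b, ← LinearMap.charpoly_toMatrix (c • φ) b,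
    LinearEquiv.map_smul, roots_charpoly_smul _ hc]

/-! ### Subspaces of `kⁿ` carry the module topology -/

/-- A linear subspace of `Fin n → k` (product topology), with the subspace topology, has the
`k`-module topology: it is linearly homeomorphic to `Fin e → k` via a basis (coordinates are
restrictions of linear, hence continuous, maps on `Fin n → k`). [folklore] -/
theorem isModuleTopology_submodule_pi {k : Type*} [Field k] [TopologicalSpace k]
    [IsTopologicalRing k] {n : ℕ} (W : Submodule k (Fin n → k)) :
    IsModuleTopology k W := by
  let b := Module.finBasis k W
  -- the coordinate map `W → (Fin _ → k)` is the restriction of a linear map on `Fin n → k`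
  obtain ⟨ψ, hψ⟩ := LinearMap.exists_leftInverse_of_injective W.subtype W.ker_subtype
  have hcoord : Continuous (b.equivFun : W → Fin (Module.finrank k W) → k) := by
    have h1 : (b.equivFun : W → Fin (Module.finrank k W) → k) =
        (b.equivFun.toLinearMap.comp ψ) ∘ (Subtype.val : W → Fin n → k) := by
      funext w
      change b.equivFun w = b.equivFun (ψ (W.subtype w))
      rw [← LinearMap.comp_apply, hψ, LinearMap.id_apply]
    rw [h1]
    exact (LinearMap.continuous_on_pi _).comp continuous_subtype_val
  have hinv : Continuous (b.equivFun.symm : (Fin (Module.finrank k W) → k) → W) :=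
    IsModuleTopology.continuous_of_linearMap b.equivFun.symm.toLinearMap
  exact IsModuleTopology.iso
    (⟨b.equivFun.symm, hinv, hcoord⟩ : (Fin (Module.finrank k W) → k) ≃L[k] W)

/-! ### Framed representations: character and characteristic polynomial -/

section Framed

variable {G : Type*} [Group G] [TopologicalSpace G] {A : Type*} [CommRing A] [TopologicalSpace A]
  {n : ℕ}

/-- The operators of the representation underlying a framed representation are `Matrix.toLin'`
of the matrices. [folklore] -/
theorem _root_.Literature.NumberTheory.GaloisRepresentations.FramedRep.toRepresentation_apply_eq_toLin'
    (ρ : FramedRep G A n) (g : G) :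
    ρ.toRepresentation g = Matrix.toLin' ((ρ g : GL (Fin n) A) : Matrix (Fin n) (Fin n) A) :=
  LinearMap.ext fun v => by rw [FramedRep.toRepresentation_apply_apply, Matrix.toLin'_apply]

/-- The characteristic polynomial of a framed representation at `g` is that of the underlying
endomorphism. [folklore] -/
theorem _root_.Literature.NumberTheory.GaloisRepresentations.FramedRep.charpoly_eq_charpoly_toRepresentation
    [Nontrivial A] (ρ : FramedRep G A n) (g : G) :
    FramedRep.charpoly ρ g = (ρ.toRepresentation g).charpoly := by
  rw [FramedRep.toRepresentation_apply_eq_toLin', Matrix.charpoly_toLin']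
  rfl

/-- The character of the representation underlying a framed representation is its trace
function. [folklore] -/
theorem _root_.Literature.NumberTheory.GaloisRepresentations.FramedRep.character_toRepresentation
    {A : Type*} [Field A] [TopologicalSpace A] (ρ : FramedRep G A n) :
    ρ.toRepresentation.character = ρ.trace := by
  funext g
  rw [Representation.character, FramedRep.toRepresentation_apply_eq_toLin', Matrix.trace_toLin'_eq]
  rfl

end Framed

/-! ### The proposition for `ℳ` unbounded above -/

section Main

open _root_.Topology

variable {Γ : Type} [Group Γ] [TopologicalSpace Γ] [IsTopologicalGroup Γ]
  {k : Type} [Field k] [IsAlgClosed k] [CharZero k] [TopologicalSpace k]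
  [IsTopologicalDivisionRing k] [T2Space k]

/-- **Harris–Lan–Taylor–Thorne's Prop. 7.12 for `ℳ` unbounded above** (the general case,
`HarrisLanTaylorThorne2016.prop712Hausdorff_holds` in `TwistedSumDecompositionProofs`, reduces
to this one by `μ ↦ μ⁻¹`, `ℳ ↦ -ℳ`).  Hypotheses as in `prop712Hausdorff` (`k` algebraically
closed of characteristic `0`, Hausdorff topological field; `𝔉 ⊆ Γ` dense; `μ(f)` of infinite
order, `𝔈ⁱ_f` `d`-element multisets of non-zero elements, `ρ_m` continuous semisimple of
dimension `2d` with roots `𝔈¹_f ⊔ 𝔈²_f μ(f)ᵐ`, for `f ∈ 𝔉`, `m ∈ ℳ`).  Proof: traces on `𝔉`,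
continuity and density give the three-term character identity on `Γ`, Brauer–Nesbitt
(`Representation.nonempty_equiv_of_character_eq_of_isSemisimple`) the three-term equivalences,
`TwistedSum.exists_isCompl_forall_equiv_prod_twist` gives `ρ_m ≃ A ⊕ B ⊗ μ^{m-m₀}` for large
`m ∈ ℳ`, the generic-twist lemma identifies the roots of `A` and `B ⊗ μ^{-m₀}` on `𝔉` with
`𝔈¹`, `𝔈²` (so both have dimension `d`), and framing the two (continuous) subrepresentations
of `ρ_{m₀}` by bases gives `ρ¹`, `ρ²`. [folklore] -/
theorem exists_framedRep_of_unbounded (𝔉 : Set Γ) (h𝔉 : Dense 𝔉) (d : ℕ)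
    (μ : Γ →ₜ* kˣ) (hμ : ∀ f ∈ 𝔉, ¬ IsOfFinOrder (μ f)) (𝔈₁ 𝔈₂ : Γ → Multiset k)
    (h𝔈 : ∀ f ∈ 𝔉, Multiset.card (𝔈₁ f) = d ∧ Multiset.card (𝔈₂ f) = d ∧
      (0 : k) ∉ 𝔈₁ f ∧ (0 : k) ∉ 𝔈₂ f)
    (ℳ : Set ℤ) (hℳ : ∀ N : ℤ, ∃ m ∈ ℳ, N ≤ m) (ρ : ℤ → FramedRep Γ k (2 * d))
    (hss : ∀ m ∈ ℳ, (ρ m).toContinuousRep.IsSemisimple)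
    (hρ : ∀ m ∈ ℳ, ∀ f ∈ 𝔉, (FramedRep.charpoly (ρ m) f).roots =
      𝔈₁ f + (𝔈₂ f).map (· * (((μ f) ^ m : kˣ) : k))) :
    ∃ (ρ₁ ρ₂ : FramedRep Γ k d),
      ρ₁.toContinuousRep.IsSemisimple ∧ ρ₂.toContinuousRep.IsSemisimple ∧
      ∀ f ∈ 𝔉, (FramedRep.charpoly ρ₁ f).roots = 𝔈₁ f ∧ (FramedRep.charpoly ρ₂ f).roots = 𝔈₂ f := by
  classical
  haveI : Nonempty Γ := ⟨1⟩
  obtain ⟨f₀, hf₀⟩ := h𝔉.nonempty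
  -- the underlying representations and their characters
  let R : ℤ → Representation k Γ (Fin (2 * d) → k) := fun m => (ρ m).toRepresentation
  have hssR : ∀ m ∈ ℳ, (R m).IsSemisimpleRepresentation := hss
  let μ' : Γ →* kˣ := μ.toMonoidHom
  have hμ'pow : ∀ (n : ℤ) (g : Γ), (((μ' ^ n) g : kˣ) : k) = (((μ g) ^ n : kˣ) : k) := fun n g => by
    rw [MonoidHom.zpow_apply]; rfl
  have hcontu : ∀ n : ℤ, Continuous fun g => (((μ g) ^ n : kˣ) : k) := fun n =>
    Units.continuous_val.comp ((continuous_zpow n).comp μ.continuous_toFun)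
  have hcontR : ∀ m, Continuous (R m).character := fun m => by
    rw [show (R m).character = (ρ m).trace from FramedRep.character_toRepresentation (ρ m)]
    exact FramedRep.continuous_trace (ρ m)
  have hchar : ∀ m ∈ ℳ, ∀ f ∈ 𝔉, (R m).character f =
      (𝔈₁ f).sum + (𝔈₂ f).sum * (((μ f) ^ m : kˣ) : k) := by
    intro m hm f hf
    rw [show (R m).character f = (ρ m).trace f from
      congrFun (FramedRep.character_toRepresentation (ρ m)) f, FramedRep.trace,
      Matrix.trace_eq_sum_roots_charpoly, ← FramedRep.charpoly, hρ m hm f hf, Multiset.sum_add,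
      Multiset.sum_map_mul_right, Multiset.map_id']
  /- Step 1: the three-term equivalences (characters agree on `𝔉`, hence on `Γ`; Brauer–Nesbitt). -/
  have h3 : ∀ m₁ ∈ ℳ, ∀ m₂ ∈ ℳ, ∀ m₃ ∈ ℳ, Nonempty (Representation.Equiv
      ((Representation.twist (R m₁) (μ' ^ m₂)).prod
        ((Representation.twist (R m₂) (μ' ^ m₃)).prod (Representation.twist (R m₃) (μ' ^ m₁))))
      ((Representation.twist (R m₁) (μ' ^ m₃)).prod
        ((Representation.twist (R m₂) (μ' ^ m₁)).prod (Representation.twist (R m₃) (μ' ^ m₂))))) := by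
    intro m₁ hm₁ m₂ hm₂ m₃ hm₃
    haveI := hssR m₁ hm₁
    haveI := hssR m₂ hm₂
    haveI := hssR m₃ hm₃
    apply Representation.nonempty_equiv_of_character_eq_of_isSemisimple
    simp only [Representation.char_prod]
    have hform : ∀ a b c : ℤ,
        (Representation.twist (R m₁) (μ' ^ a)).character +
          ((Representation.twist (R m₂) (μ' ^ b)).character +
            (Representation.twist (R m₃) (μ' ^ c)).character) =
        fun g => (((μ g) ^ a : kˣ) : k) * (R m₁).character g +
          ((((μ g) ^ b : kˣ) : k) * (R m₂).character g +
            (((μ g) ^ c : kˣ) : k) * (R m₃).character g) := by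
      intro a b c
      funext g
      simp only [Pi.add_apply, Representation.character_twist, hμ'pow]
    rw [hform, hform]
    apply Continuous.ext_on h𝔉
    · exact ((hcontu _).mul (hcontR _)).add (((hcontu _).mul (hcontR _)).add
        ((hcontu _).mul (hcontR _)))
    · exact ((hcontu _).mul (hcontR _)).add (((hcontu _).mul (hcontR _)).add
        ((hcontu _).mul (hcontR _)))
    · intro f hf
      simp only [hchar m₁ hm₁ f hf, hchar m₂ hm₂ f hf, hchar m₃ hm₃ f hf]
      ring
  /- Step 2: the algebraic core. -/
  obtain ⟨m₀, hm₀, A, B, -, hAss, hBss, M, hM⟩ :=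
    exists_isCompl_forall_equiv_prod_twist μ' (hμ f₀ hf₀) ℳ hℳ R hssR h3
  haveI := hAss
  haveI := hBss
  /- Step 3: characteristic polynomials. -/
  have hroots : ∀ m ∈ ℳ, M ≤ m → ∀ f : Γ, (FramedRep.charpoly (ρ m) f).roots =
      (A.toRepresentation f).charpoly.roots +
        (B.toRepresentation f).charpoly.roots.map ((((μ f) ^ (m - m₀) : kˣ) : k) * ·) := by
    intro m hm hMm f
    obtain ⟨e⟩ := hM m hm hMm
    rw [FramedRep.charpoly_eq_charpoly_toRepresentation,
      show (ρ m).toRepresentation f = R m f from rfl,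
      ← LinearEquiv.charpoly_conj e.toLinearEquiv (R m f), Representation.Equiv.conj_apply_self,
      show (A.toRepresentation.prod (Representation.twist B.toRepresentation (μ' ^ (m - m₀)))) f =
        (A.toRepresentation f).prodMap (Representation.twist B.toRepresentation (μ' ^ (m - m₀)) f)
        from rfl, LinearMap.charpoly_prodMap,
      Polynomial.roots_mul ((LinearMap.charpoly_monic _).mul (LinearMap.charpoly_monic _)).ne_zero,
      Representation.twist_apply, roots_charpoly_smul_linearMap _ (Units.ne_zero _), hμ'pow]
  -- the generic-twist lemma on `𝔉`
  have hgen : ∀ f ∈ 𝔉, (A.toRepresentation f).charpoly.roots = 𝔈₁ f ∧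
      (B.toRepresentation f).charpoly.roots.map ((((μ f) ^ (-m₀) : kˣ) : k) * ·) = 𝔈₂ f := by
    intro f hf
    have hS : {m ∈ ℳ | M ≤ m}.Infinite := by
      apply Set.infinite_of_not_bddAbove
      rintro ⟨N, hN⟩
      obtain ⟨m, hm, hNm⟩ := hℳ (max N M + 1)
      have := hN ⟨hm, by omega⟩
      omega
    obtain ⟨m₁, hm₁, hMm₁⟩ := hℳ M
    have h0 : (0 : k) ∉ (A.toRepresentation f).charpoly.roots := by
      intro h0
      have h1 : (0 : k) ∈ (FramedRep.charpoly (ρ m₁) f).roots := by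
        rw [hroots m₁ hm₁ hMm₁ f]
        exact Multiset.mem_add.mpr (Or.inl h0)
      rw [hρ m₁ hm₁ f hf, Multiset.mem_add, Multiset.mem_map] at h1
      rcases h1 with h1 | ⟨x, hx, hx0⟩
      · exact (h𝔈 f hf).2.2.1 h1
      · rcases mul_eq_zero.mp hx0 with h2 | h2
        · exact (h𝔈 f hf).2.2.2 (h2 ▸ hx)
        · exact Units.ne_zero _ h2
    refine multiset_eq_of_forall_add_map_mul_zpow_eq (hμ f hf) hS h0 (h𝔈 f hf).2.2.1
      fun m hm => ?_
    rw [← hρ m hm.1 f hf, hroots m hm.1 hm.2 f, Multiset.map_map]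
    congr 2
    funext x
    simp only [Function.comp_apply]
    rw [mul_comm _ (((μ f ^ m : kˣ)) : k), ← mul_assoc, ← Units.val_mul, ← zpow_add,
      ← sub_eq_add_neg]
  /- Step 4: dimensions, bases, frames. -/
  have hsplit : ∀ {W : Type} [AddCommGroup W] [Module k W] [FiniteDimensional k W]
      (φ : Module.End k W), Multiset.card φ.charpoly.roots = Module.finrank k W := by
    intro W _ _ _ φ
    rw [← LinearMap.charpoly_natDegree φ]
    exact Polynomial.splits_iff_card_roots.mp (IsAlgClosed.splits _)
  have hdA : Module.finrank k A.toSubmodule = d := by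
    rw [← hsplit (A.toRepresentation f₀), (hgen f₀ hf₀).1, (h𝔈 f₀ hf₀).1]
  have hdB : Module.finrank k B.toSubmodule = d := by
    rw [← hsplit (B.toRepresentation f₀),
      ← Multiset.card_map ((((μ f₀) ^ (-m₀) : kˣ) : k) * ·), (hgen f₀ hf₀).2, (h𝔈 f₀ hf₀).2.1]
  let bA := Module.finBasisOfFinrankEq k A.toSubmodule hdA
  let bB := Module.finBasisOfFinrankEq k B.toSubmodule hdB
  haveI : IsModuleTopology k A.toSubmodule := isModuleTopology_submodule_pi _
  haveI : IsModuleTopology k B.toSubmodule := isModuleTopology_submodule_pi _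
  have hMcont : Continuous fun g : Γ =>
      (((ρ m₀) g : GL (Fin (2 * d)) k) : Matrix (Fin (2 * d)) (Fin (2 * d)) k) :=
    Units.continuous_val.comp (map_continuous (ρ m₀))
  -- the two subrepresentations of `ρ m₀` as continuous representations
  let σA : ContinuousRep Γ k A.toSubmodule := ⟨A.toRepresentation, by
    rw [IsInducing.subtypeVal.continuous_iff]
    change Continuous fun p : Γ × A.toSubmodule => Matrix.mulVec
      (((ρ m₀) p.1 : GL (Fin (2 * d)) k) : Matrix (Fin (2 * d)) (Fin (2 * d)) k)
        (p.2 : Fin (2 * d) → k)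
    exact (hMcont.comp continuous_fst).matrix_mulVec (continuous_subtype_val.comp continuous_snd)⟩
  let σB : ContinuousRep Γ k B.toSubmodule :=
    ⟨Representation.twist B.toRepresentation (μ' ^ (-m₀)), by
      rw [IsInducing.subtypeVal.continuous_iff]
      change Continuous fun p : Γ × B.toSubmodule => ((((μ' ^ (-m₀)) p.1 : kˣ) : k) •
        Matrix.mulVec (((ρ m₀) p.1 : GL (Fin (2 * d)) k) : Matrix (Fin (2 * d)) (Fin (2 * d)) k)
          (p.2 : Fin (2 * d) → k))
      have hc : Continuous fun p : Γ × B.toSubmodule => (((μ' ^ (-m₀)) p.1 : kˣ) : k) := by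
        simp only [hμ'pow]
        exact (hcontu (-m₀)).comp continuous_fst
      exact hc.smul ((hMcont.comp continuous_fst).matrix_mulVec
        (continuous_subtype_val.comp continuous_snd))⟩
  refine ⟨σA.frame bA, σB.frame bB, ?_, ?_, fun f hf => ⟨?_, ?_⟩⟩
  · exact Representation.isSemisimpleRepresentation_of_equiv (σA.frameEquiv bA).toRepEquiv.symm
  · exact Representation.isSemisimpleRepresentation_of_equiv (σB.frameEquiv bB).toRepEquiv.symm
  · rw [FramedRep.charpoly, ContinuousRep.coe_frame_apply, LinearMap.charpoly_toMatrix]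
    exact (hgen f hf).1
  · rw [FramedRep.charpoly, ContinuousRep.coe_frame_apply, LinearMap.charpoly_toMatrix]
    change (Representation.twist B.toRepresentation (μ' ^ (-m₀)) f).charpoly.roots = 𝔈₂ f
    rw [Representation.twist_apply, roots_charpoly_smul_linearMap _ (Units.ne_zero _), hμ'pow]
    exact (hgen f hf).2

end Main

end TwistedSum

end Literature.NumberTheory.GaloisRepresentations
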